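import Summits.HodgeConjecture.CorCM.Model.PolarMatrix
import HarnessLib

/-!
# Ring 2 · sub-cell AbelianAll (ALL ABELIAN VARIETIES), André axis, part XXXVIII-e₁ — PAIRS OF POLAR CLASSES IN THE TOP DEGREE:
# on a complex abelian variety `A` of dimension `g = k + 2`, for a basis `b` of `H¹(A(ℂ); ℚ)` and the polar family `y` of `θ`
# (`ℓ(θ) = Σ_a pr₁^* b_a ∪ pr₂^* y_a`), the "two-pair matching formula"
# `(k+1) · u ∪ w ∪ y_a ∪ y_c ∪ θᵏ = b^*_c(y_a) · u ∪ w ∪ θ^{k+1} − (k+2)⁻¹ (b^*_c(w) b^*_a(u) − b^*_a(w) b^*_c(u)) · θ^{k+2}`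
# and its traced double sum `(k+1)(k+2) Σ_{a,c} τ(x ∪ y_a ∪ y_c ∪ θᵏ) · b_a ∪ b_c = 2(k+2) τ(x ∪ θ^{k+1}) · θ − 2 τ(θ^{k+2}) · x`
# — the rational heart of the Kleiman coefficient of the block `b = 1` (part XXXVIII-e₂: `[ℓ(θ)²]_* ∘ L^{g-2}` on `H²(A)`)

HONEST FRAMING (page 1, verbatim): **research route, not a corollary; conditional on HC_CM plus one named
minimal statement.** Cell line: research route conditional on HC_CM; not a corollary; Q11.4-sentence-2
already refuted in dim ≥ 3. Nothing in this file proves a case of the Hodge conjecture; `HC_CM` does not occur.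

Gen-30 file of the `ab-andre-2` seat (cell `pub-hodge-ring2`, sub-cell AbelianAll = ALL abelian varieties, not Weil-type-only).

## What this file proves (sorry-free, standard axioms only; on the RATIONAL Betti carriers of the COR-CM model layer)

For `A : AbelianVariety ℂ`, `k + 2 = dim A`, a basis `b` of `H¹(A(ℂ); ℚ)`, `θ ∈ H²(A(ℂ); ℚ)` and its polar family `y` along `b`:
* `smul_cup_polar_cupPow_eq_coord_smul` — `(k+2) · x ∪ (y_a ∪ θ^{k+1}) = b^*_a(x) · θ^{k+2}` for EVERY `x ∈ H¹` (COR-CM's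
  `smul_cup_polar_cup_cupPow` is the case `x = b_{a'}`);
* **`smul_cup_cup_polar_polar_cupPow`** — the two-pair matching formula displayed in the title (the graded-derivation calculus of
  COR-CM's `PolarContraction`: `y_c = D_c θ`, `D_c(θ^{j+1}) = (j+1) D_cθ ∪ θʲ`, Leibniz, and `x ∪ D_c ω = b^*_c(x) ω` on the top degree);
* **`sum_sum_smul_cup_eq`** — for every `ℚ`-linear functional `τ` on the top degree and every `x ∈ H²(A(ℂ); ℚ)`:
  `(k+1)(k+2) · Σ_a Σ_c τ(x ∪ y_a ∪ y_c ∪ θᵏ) · b_a ∪ b_c = (τ(x ∪ θ^{k+1}) · 2(k+2)) · θ − (2 τ(θ^{k+2})) · x`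
  (the matching formula on `x = u ∪ w`; the Euler identity `Σ_a b_a ∪ y_a = 2θ` of COR-CM's `PolarMatrix`; `Σ_a b^*_a(u) b_a = u`; both
  sides are linear in `x` and the `u ∪ w` span `H²`).
In representation-theoretic terms: `End_{Sp(H¹)}(⋀²H¹) = ⟨id, x ↦ ⟨x θ^{g-1}⟩ θ⟩`, and the correspondence `ℓ(θ)²` composed with `L^{g-2}`
is the displayed element of it (part XXXVIII-e₂ turns this into the Kleiman identity of the block `b = 1`).

## Documentary interface

PRINT: Kleiman, Dix exposés, App. to §2, 2A8–2A11; [MumfordAV1970, §1 (4), §16]; Beauville, LNM 1016 (1983), Prop. 1 and §3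
(Fourier transform and Lefschetz powers); [LangeBirkenhake1992, Lemma 1.1.17]. LEAN: displayed theorems, definition-free, fact-free.
-/

noncomputable section

set_option linter.dupNamespace false

namespace Summit.HodgeConjecture.HodgeConjecture.Ring2.AbelianAll

open CategoryTheory MonoidalCategory CartesianMonoidalCategory
open Literature.AlgebraicTopology.SingularHomology
open Literature.AlgebraicTopology.CharacteristicClasses (cupPow cupPow_zero cupPow_succ)
open Literature.AlgebraicGeometry.Motives (SchemeOver ComplexPoints IsSmoothProjective bettiCohomology AbelianVariety)
open Literature.AlgebraicGeometry.HodgeTheory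
open Summit.HodgeConjecture.CorCM.Model
open scoped MonObj

variable (A : AbelianVariety ℂ)

/-- **`(k+2) · x ∪ (y_a ∪ θ^{k+1}) = b^*_a(x) · θ^{k+2}` for every `x ∈ H¹(A(ℂ); ℚ)`** (`k + 2 = dim A`): `(k+2) y_a ∪ θ^{k+1} = D_a(θ^{k+2})`
and `x ∪ D_a ω = b^*_a(x) ω` on the top degree. COR-CM's `smul_cup_polar_cup_cupPow` is the case `x = b_{a'}`. [cite: MumfordAV1970, §16] -/
theorem smul_cup_polar_cupPow_eq_coord_smul {n k : ℕ} (hk : k + 2 = A.dim) (b : Module.Basis (Fin n) ℚ (bettiCohomology A.X 1))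
    {θ : bettiCohomology A.X 2} {y : Fin n → bettiCohomology A.X 1}
    (hℓ : BettiUniverse.pull μ[A.X] 2 θ - BettiUniverse.pull (fst A.X A.X) 2 θ - BettiUniverse.pull (snd A.X A.X) 2 θ =
      ∑ a, BettiUniverse.cup (A.X ⊗ A.X) 1 1 (BettiUniverse.pull (fst A.X A.X) 1 (b a))
        (BettiUniverse.pull (snd A.X A.X) 1 (y a)))
    (a : Fin n) (x : bettiCohomology A.X 1) :
    ((k + 2 : ℕ) : ℚ) • cupProduct (Nat.add_comm 1 (2 * k + 1 + 1 + 1)) x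
        (cupProduct (Nat.add_comm 1 (2 * k + 1 + 1)) (y a) (cupPow ℚ θ (k + 1))) =
      b.coord a x • cupPow ℚ θ (k + 2) := by
  have h := hasExteriorCohomologyH1_rat A
  have hex := fun c : Fin n ↦ exists_contraction h (b.coord c)
  choose D hD using hex
  haveI : Subsingleton (singularCohomology ℚ ℚ (ComplexPoints A.X) (2 * k + 1 + 1 + 1 + 2)) :=
    subsingleton_bettiCohomology_of_lt A (by omega)
  have e1 : ((k + 2 : ℕ) : ℚ) • cupProduct (Nat.add_comm 1 (2 * k + 1 + 1)) (y a) (cupPow ℚ θ (k + 1)) =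
      D a (2 * k + 1 + 1 + 1) (cupPow ℚ θ (k + 2)) := by
    rw [polarFamily_eq_contraction A b hℓ D hD a]
    exact (contraction_cupPow (b.coord a) (D a) h (hD a) θ (k + 1)).symm
  rw [← map_smul, e1]
  exact cup_contraction_top (b.coord a) (D a) h (hD a) (2 * k + 1 + 1 + 1) x (cupPow ℚ θ (k + 2))

/-- **THE TWO-PAIR MATCHING FORMULA.** For `k + 2 = dim A`, a basis `b` of `H¹(A(ℂ); ℚ)`, the polar family `y` of `θ` along `b`,
indices `a, c` and classes `u, w ∈ H¹(A(ℂ); ℚ)`: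
`(k+1) · u ∪ (w ∪ (y_a ∪ (y_c ∪ θᵏ))) = b^*_c(y_a) · u ∪ (w ∪ θ^{k+1}) − (k+2)⁻¹ (b^*_c(w) b^*_a(u) − b^*_a(w) b^*_c(u)) · θ^{k+2}`.
(The three perfect matchings of `{u, w, y_a, y_c}` against the form `θ^{k+•}`: `y_c = D_c θ`, `(k+1) y_c ∪ θᵏ = D_c(θ^{k+1})`, Leibniz
`x ∪ D_c z = b^*_c(x) z − D_c(x ∪ z)` twice, and `(k+2) x ∪ (y_a ∪ θ^{k+1}) = b^*_a(x) θ^{k+2}`.) [cite: MumfordAV1970, §16]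
[cite: Kleiman1968AlgebraicCycles, App. to §2, 2A8–2A10] -/
theorem smul_cup_cup_polar_polar_cupPow {n k : ℕ} (hk : k + 2 = A.dim) (b : Module.Basis (Fin n) ℚ (bettiCohomology A.X 1))
    {θ : bettiCohomology A.X 2} {y : Fin n → bettiCohomology A.X 1}
    (hℓ : BettiUniverse.pull μ[A.X] 2 θ - BettiUniverse.pull (fst A.X A.X) 2 θ - BettiUniverse.pull (snd A.X A.X) 2 θ =
      ∑ a, BettiUniverse.cup (A.X ⊗ A.X) 1 1 (BettiUniverse.pull (fst A.X A.X) 1 (b a))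
        (BettiUniverse.pull (snd A.X A.X) 1 (y a)))
    (a c : Fin n) (u w : bettiCohomology A.X 1) :
    ((k + 1 : ℕ) : ℚ) • cupProduct (Nat.add_comm 1 (2 * k + 1 + 1 + 1)) u
        (cupProduct (Nat.add_comm 1 (2 * k + 1 + 1)) w
          (cupProduct (Nat.add_comm 1 (2 * k + 1)) (y a)
            (cupProduct (show 1 + 2 * k = 2 * k + 1 by omega) (y c) (cupPow ℚ θ k)))) =
      b.coord c (y a) • cupProduct (Nat.add_comm 1 (2 * k + 1 + 1 + 1)) u
          (cupProduct (Nat.add_comm 1 (2 * k + 1 + 1)) w (cupPow ℚ θ (k + 1))) -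
        (((k + 2 : ℕ) : ℚ)⁻¹ * (b.coord c w * b.coord a u - b.coord a w * b.coord c u)) • cupPow ℚ θ (k + 2) := by
  have h := hasExteriorCohomologyH1_rat A
  have hex := fun c : Fin n ↦ exists_contraction h (b.coord c)
  choose D hD using hex
  have hk2 : ((k + 2 : ℕ) : ℚ) ≠ 0 := by exact_mod_cast Nat.succ_ne_zero (k + 1)
  -- (1) `(k+1) y_a ∪ (y_c ∪ θᵏ) = b^*_c(y_a) θ^{k+1} − D_c Ω`, `Ω = y_a ∪ θ^{k+1}`
  have s1 : ((k + 1 : ℕ) : ℚ) • cupProduct (Nat.add_comm 1 (2 * k + 1)) (y a)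
      (cupProduct (show 1 + 2 * k = 2 * k + 1 by omega) (y c) (cupPow ℚ θ k)) =
      b.coord c (y a) • cupPow ℚ θ (k + 1) -
        D c (2 * k + 1 + 1) (cupProduct (Nat.add_comm 1 (2 * k + 1 + 1)) (y a) (cupPow ℚ θ (k + 1))) := by
    have e0 : ((k + 1 : ℕ) : ℚ) • cupProduct (show 1 + 2 * k = 2 * k + 1 by omega) (y c) (cupPow ℚ θ k) =
        D c (2 * k + 1) (cupPow ℚ θ (k + 1)) := by
      rw [polarFamily_eq_contraction A b hℓ D hD c]
      exact (contraction_cupPow (b.coord c) (D c) h (hD c) θ k).symm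
    have e1 := contraction_cup_one (b.coord c) (D c) h (hD c) (2 * k + 1) (y a) (cupPow ℚ θ (k + 1))
    rw [← map_smul, e0, e1, sub_sub_cancel]
  -- (2) `(k+2) x ∪ Ω = b^*_a(x) θ^{k+2}` and `(k+2) x ∪ (y_c ∪ θ^{k+1}) = b^*_c(x) θ^{k+2}` for every `x`
  have s2 : ∀ (e : Fin n) (x : bettiCohomology A.X 1), cupProduct (Nat.add_comm 1 (2 * k + 1 + 1 + 1)) x
      (cupProduct (Nat.add_comm 1 (2 * k + 1 + 1)) (y e) (cupPow ℚ θ (k + 1))) =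
      (((k + 2 : ℕ) : ℚ)⁻¹ * b.coord e x) • cupPow ℚ θ (k + 2) := by
    intro e x
    rw [mul_smul, ← smul_cup_polar_cupPow_eq_coord_smul A hk b hℓ e x, smul_smul, inv_mul_cancel₀ hk2, one_smul]
  -- (3) `D_c(θ^{k+2}) = (k+2) y_c ∪ θ^{k+1}`
  have s3 : D c (2 * k + 1 + 1 + 1) (cupPow ℚ θ (k + 2)) =
      ((k + 2 : ℕ) : ℚ) • cupProduct (Nat.add_comm 1 (2 * k + 1 + 1)) (y c) (cupPow ℚ θ (k + 1)) := by
    rw [polarFamily_eq_contraction A b hℓ D hD c]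
    exact contraction_cupPow (b.coord c) (D c) h (hD c) θ (k + 1)
  -- (4) `w ∪ D_c Ω = b^*_c(w) Ω − ((k+2)⁻¹ b^*_a(w)) D_c(θ^{k+2})`
  have s4 : cupProduct (Nat.add_comm 1 (2 * k + 1 + 1)) w
      (D c (2 * k + 1 + 1) (cupProduct (Nat.add_comm 1 (2 * k + 1 + 1)) (y a) (cupPow ℚ θ (k + 1)))) =
      b.coord c w • cupProduct (Nat.add_comm 1 (2 * k + 1 + 1)) (y a) (cupPow ℚ θ (k + 1)) -
        (((k + 2 : ℕ) : ℚ)⁻¹ * b.coord a w) • D c (2 * k + 1 + 1 + 1) (cupPow ℚ θ (k + 2)) := by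
    have e1 := contraction_cup_one (b.coord c) (D c) h (hD c) (2 * k + 1 + 1) w
      (cupProduct (Nat.add_comm 1 (2 * k + 1 + 1)) (y a) (cupPow ℚ θ (k + 1)))
    rw [s2 a w, map_smul] at e1
    rw [e1, sub_sub_cancel]
  -- assemble
  rw [← map_smul, ← map_smul, s1, map_sub, map_smul, map_sub, map_smul, s4, map_sub, map_smul, map_smul, s3, map_smul, s2 a u, s2 c u]
  simp only [smul_smul, ← sub_smul]
  congr 1
  field_simp

/-- **THE TRACED DOUBLE SUM.** For `k + 2 = dim A`, a basis `b` of `H¹(A(ℂ); ℚ)`, the polar family `y` of `θ` along `b`, every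
`ℚ`-linear functional `τ` on `H^{2k+4}(A(ℂ); ℚ)` and every `x ∈ H²(A(ℂ); ℚ)`:
`(k+1)(k+2) · Σ_a Σ_c τ(x ∪ (y_a ∪ (y_c ∪ θᵏ))) · b_a ∪ b_c = (τ(x ∪ θ^{k+1}) · 2(k+2)) · θ − (2 τ(θ^{k+2})) · x` — from the two-pair
matching formula on `x = u ∪ w`, the Euler identity `Σ_a b_a ∪ y_a = 2θ` and `Σ_a b^*_a(u) b_a = u`; both sides are linear in `x` and the
`u ∪ w` span `H²`. (For `τ = tr` this computes the correspondence `[ℓ(θ)²]_* ∘ L^{g-2}` on `H²(A)`: `End_{Sp}(⋀²H¹)` is spanned by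
`id` and `x ↦ ⟨x θ^{g-1}⟩ θ`.) [cite: MumfordAV1970, §1 (4) and §16] [cite: Kleiman1968AlgebraicCycles, App. to §2, 2A9–2A11] -/
theorem sum_sum_smul_cup_eq {n k : ℕ} (hk : k + 2 = A.dim) (b : Module.Basis (Fin n) ℚ (bettiCohomology A.X 1))
    {θ : bettiCohomology A.X 2} {y : Fin n → bettiCohomology A.X 1}
    (hℓ : BettiUniverse.pull μ[A.X] 2 θ - BettiUniverse.pull (fst A.X A.X) 2 θ - BettiUniverse.pull (snd A.X A.X) 2 θ =
      ∑ a, BettiUniverse.cup (A.X ⊗ A.X) 1 1 (BettiUniverse.pull (fst A.X A.X) 1 (b a))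
        (BettiUniverse.pull (snd A.X A.X) 1 (y a)))
    (τ : bettiCohomology A.X (2 * k + 1 + 1 + 1 + 1) →ₗ[ℚ] ℚ) (x : bettiCohomology A.X 2) :
    (((k + 1) * (k + 2) : ℕ) : ℚ) • ∑ a, ∑ c, τ (cupProduct (show 2 + (2 * k + 1 + 1) = 2 * k + 1 + 1 + 1 + 1 by omega) x
        (cupProduct (Nat.add_comm 1 (2 * k + 1)) (y a) (cupProduct (show 1 + 2 * k = 2 * k + 1 by omega) (y c) (cupPow ℚ θ k)))) •
          BettiUniverse.cup A.X 1 1 (b a) (b c) =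
      (τ (cupProduct (show 2 + 2 * (k + 1) = 2 * k + 1 + 1 + 1 + 1 by omega) x (cupPow ℚ θ (k + 1))) * (2 * ((k + 2 : ℕ) : ℚ))) • θ -
        (2 * τ (cupPow ℚ θ (k + 2))) • x := by
  have hk1 : ((k + 1 : ℕ) : ℚ) ≠ 0 := by exact_mod_cast Nat.succ_ne_zero k
  have hk2 : ((k + 2 : ℕ) : ℚ) ≠ 0 := by exact_mod_cast Nat.succ_ne_zero (k + 1)
  -- both sides as linear maps in `x`
  set F : bettiCohomology A.X 2 →ₗ[ℚ] bettiCohomology A.X 2 := (((k + 1) * (k + 2) : ℕ) : ℚ) •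
    ∑ a, ∑ c, (τ ∘ₗ (cupProduct (show 2 + (2 * k + 1 + 1) = 2 * k + 1 + 1 + 1 + 1 by omega)).flip
      (cupProduct (Nat.add_comm 1 (2 * k + 1)) (y a) (cupProduct (show 1 + 2 * k = 2 * k + 1 by omega) (y c) (cupPow ℚ θ k)))).smulRight
      (BettiUniverse.cup A.X 1 1 (b a) (b c)) with hF
  set G : bettiCohomology A.X 2 →ₗ[ℚ] bettiCohomology A.X 2 :=
    (τ ∘ₗ (cupProduct (show 2 + 2 * (k + 1) = 2 * k + 1 + 1 + 1 + 1 by omega)).flip (cupPow ℚ θ (k + 1))).smulRight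
        ((2 * ((k + 2 : ℕ) : ℚ)) • θ) -
      (2 * τ (cupPow ℚ θ (k + 2))) • LinearMap.id with hG
  have hFx : ∀ z : bettiCohomology A.X 2, F z = (((k + 1) * (k + 2) : ℕ) : ℚ) • ∑ a, ∑ c,
      τ (cupProduct (show 2 + (2 * k + 1 + 1) = 2 * k + 1 + 1 + 1 + 1 by omega) z
        (cupProduct (Nat.add_comm 1 (2 * k + 1)) (y a) (cupProduct (show 1 + 2 * k = 2 * k + 1 by omega) (y c) (cupPow ℚ θ k)))) •
          BettiUniverse.cup A.X 1 1 (b a) (b c) := by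
    intro z
    simp only [hF, LinearMap.smul_apply, LinearMap.sum_apply, LinearMap.smulRight_apply, LinearMap.comp_apply, LinearMap.flip_apply]
  have hGx : ∀ z : bettiCohomology A.X 2, G z =
      (τ (cupProduct (show 2 + 2 * (k + 1) = 2 * k + 1 + 1 + 1 + 1 by omega) z (cupPow ℚ θ (k + 1))) * (2 * ((k + 2 : ℕ) : ℚ))) • θ -
        (2 * τ (cupPow ℚ θ (k + 2))) • z := by
    intro z
    simp only [hG, LinearMap.sub_apply, LinearMap.smul_apply, LinearMap.smulRight_apply, LinearMap.comp_apply, LinearMap.flip_apply,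
      LinearMap.id_apply, smul_smul]
  rw [← hFx, ← hGx]
  refine LinearMap.eqOn_span (R := ℚ) (s := Set.range (cupPowOne ℚ (ComplexPoints A.X) 2)) ?_
    (by rw [span_range_cupPowOne_rat_eq_top A 2]; exact Submodule.mem_top)
  rintro _ ⟨v, rfl⟩
  rw [hFx, hGx, cupPowOne_succ, cupPowOne_one]
  -- `x = u ∪ w`: reassociate and apply the matching formula under `τ`
  have hassoc : ∀ a c, cupProduct (show 2 + (2 * k + 1 + 1) = 2 * k + 1 + 1 + 1 + 1 by omega)
      (cupProduct (Nat.add_comm 1 1) (v 0) (Fin.tail v 0))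
      (cupProduct (Nat.add_comm 1 (2 * k + 1)) (y a) (cupProduct (show 1 + 2 * k = 2 * k + 1 by omega) (y c) (cupPow ℚ θ k))) =
      cupProduct (Nat.add_comm 1 (2 * k + 1 + 1 + 1)) (v 0) (cupProduct (Nat.add_comm 1 (2 * k + 1 + 1)) (Fin.tail v 0)
        (cupProduct (Nat.add_comm 1 (2 * k + 1)) (y a) (cupProduct (show 1 + 2 * k = 2 * k + 1 by omega) (y c) (cupPow ℚ θ k)))) :=
    fun a c ↦ cupProduct_assoc _ _ _ _ _ _ _
  have hassoc' : cupProduct (show 2 + 2 * (k + 1) = 2 * k + 1 + 1 + 1 + 1 by omega) (cupProduct (Nat.add_comm 1 1) (v 0) (Fin.tail v 0))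
      (cupPow ℚ θ (k + 1)) =
      cupProduct (Nat.add_comm 1 (2 * k + 1 + 1 + 1)) (v 0) (cupProduct (Nat.add_comm 1 (2 * k + 1 + 1)) (Fin.tail v 0) (cupPow ℚ θ (k + 1))) :=
    cupProduct_assoc _ _ _ _ _ _ _
  have key : ∀ a c, τ (cupProduct (Nat.add_comm 1 (2 * k + 1 + 1 + 1)) (v 0) (cupProduct (Nat.add_comm 1 (2 * k + 1 + 1)) (Fin.tail v 0)
      (cupProduct (Nat.add_comm 1 (2 * k + 1)) (y a) (cupProduct (show 1 + 2 * k = 2 * k + 1 by omega) (y c) (cupPow ℚ θ k))))) =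
      ((k + 1 : ℕ) : ℚ)⁻¹ * (b.coord c (y a) * τ (cupProduct (Nat.add_comm 1 (2 * k + 1 + 1 + 1)) (v 0)
        (cupProduct (Nat.add_comm 1 (2 * k + 1 + 1)) (Fin.tail v 0) (cupPow ℚ θ (k + 1))))) -
      ((k + 1 : ℕ) : ℚ)⁻¹ * (((k + 2 : ℕ) : ℚ)⁻¹ * (b.coord c (Fin.tail v 0) * b.coord a (v 0) - b.coord a (Fin.tail v 0) * b.coord c (v 0)) *
        τ (cupPow ℚ θ (k + 2))) := by
    intro a c
    have hm := congrArg τ (smul_cup_cup_polar_polar_cupPow A hk b hℓ a c (v 0) (Fin.tail v 0))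
    rw [map_smul, map_sub, map_smul, map_smul, smul_eq_mul, smul_eq_mul, smul_eq_mul] at hm
    rw [← mul_sub, ← hm, ← mul_assoc, inv_mul_cancel₀ hk1, one_mul]
  simp_rw [hassoc, key, hassoc', Finset.smul_sum, sub_smul, smul_sub, Finset.sum_sub_distrib]
  -- the two sums
  have h1 : ∀ z : bettiCohomology A.X 1, ∑ e, b.coord e z • b e = z := fun z ↦ by
    simp_rw [Module.Basis.coord_apply]; exact b.sum_repr z
  have hE := sum_cup_polarFamily_eq_two_smul A b hℓ
  have e1 : ∑ a, ∑ c, (((k + 1) * (k + 2) : ℕ) : ℚ) • ((((k + 1 : ℕ) : ℚ)⁻¹ * (b.coord c (y a) *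
      τ (cupProduct (Nat.add_comm 1 (2 * k + 1 + 1 + 1)) (v 0)
        (cupProduct (Nat.add_comm 1 (2 * k + 1 + 1)) (Fin.tail v 0) (cupPow ℚ θ (k + 1)))))) • BettiUniverse.cup A.X 1 1 (b a) (b c)) =
      (τ (cupProduct (Nat.add_comm 1 (2 * k + 1 + 1 + 1)) (v 0)
        (cupProduct (Nat.add_comm 1 (2 * k + 1 + 1)) (Fin.tail v 0) (cupPow ℚ θ (k + 1)))) * (2 * ((k + 2 : ℕ) : ℚ))) • θ := by
    have : ∀ a c, (((k + 1) * (k + 2) : ℕ) : ℚ) • ((((k + 1 : ℕ) : ℚ)⁻¹ * (b.coord c (y a) *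
        τ (cupProduct (Nat.add_comm 1 (2 * k + 1 + 1 + 1)) (v 0)
          (cupProduct (Nat.add_comm 1 (2 * k + 1 + 1)) (Fin.tail v 0) (cupPow ℚ θ (k + 1)))))) • BettiUniverse.cup A.X 1 1 (b a) (b c)) =
        (((k + 2 : ℕ) : ℚ) * τ (cupProduct (Nat.add_comm 1 (2 * k + 1 + 1 + 1)) (v 0)
          (cupProduct (Nat.add_comm 1 (2 * k + 1 + 1)) (Fin.tail v 0) (cupPow ℚ θ (k + 1))))) •
          BettiUniverse.cup A.X 1 1 (b a) (b.coord c (y a) • b c) := by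
      intro a c
      rw [map_smul, smul_smul, smul_smul]
      congr 1
      rw [Nat.cast_mul]
      field_simp
    simp_rw [this, ← Finset.smul_sum, ← map_sum, h1, hE, smul_smul]
    congr 1
    ring
  have e2 : ∑ a, ∑ c, (((k + 1) * (k + 2) : ℕ) : ℚ) • ((((k + 1 : ℕ) : ℚ)⁻¹ * (((k + 2 : ℕ) : ℚ)⁻¹ *
      (b.coord c (Fin.tail v 0) * b.coord a (v 0) - b.coord a (Fin.tail v 0) * b.coord c (v 0)) * τ (cupPow ℚ θ (k + 2)))) •
        BettiUniverse.cup A.X 1 1 (b a) (b c)) =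
      (2 * τ (cupPow ℚ θ (k + 2))) • cupProduct (Nat.add_comm 1 1) (v 0) (Fin.tail v 0) := by
    have : ∀ a c, (((k + 1) * (k + 2) : ℕ) : ℚ) • ((((k + 1 : ℕ) : ℚ)⁻¹ * (((k + 2 : ℕ) : ℚ)⁻¹ *
        (b.coord c (Fin.tail v 0) * b.coord a (v 0) - b.coord a (Fin.tail v 0) * b.coord c (v 0)) * τ (cupPow ℚ θ (k + 2)))) •
          BettiUniverse.cup A.X 1 1 (b a) (b c)) =
        τ (cupPow ℚ θ (k + 2)) • (BettiUniverse.cup A.X 1 1 (b.coord a (v 0) • b a) (b.coord c (Fin.tail v 0) • b c) -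
          BettiUniverse.cup A.X 1 1 (b.coord a (Fin.tail v 0) • b a) (b.coord c (v 0) • b c)) := by
      intro a c
      rw [LinearMap.map_smul₂, map_smul, LinearMap.map_smul₂, map_smul, smul_smul, smul_smul, smul_smul, ← sub_smul, smul_smul]
      congr 1
      rw [Nat.cast_mul]
      field_simp
    simp_rw [this, ← Finset.smul_sum, Finset.sum_sub_distrib, ← map_sum, ← LinearMap.map_sum₂, h1]
    rw [BettiUniverse.cup_comm_one (Fin.tail v 0) (v 0), sub_neg_eq_add,
      ← two_smul ℚ (((BettiUniverse.cup A.X 1 1) (v 0)) (Fin.tail v 0)), smul_smul, mul_comm (τ (cupPow ℚ θ (k + 2))) 2]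
  rw [e1, e2]

end Summit.HodgeConjecture.HodgeConjecture.Ring2.AbelianAll

end
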